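import Mathlib
import HarnessLib
import HarnessLib.Audit
import Summits.AtomisticToContinuum.Statement

/-!
Route: BECLogConcaveCounts

CLOSED (retired) 2026-08-15T13:39:16Z by operator:999:1257524 — reason: not-a-thesis: assembly does not conclude the sub-problem Statement — note: D-0027 §2.1 audit (human 2026-08-15: routes that do not decide the summit are removed): the assembly concludes `Literature.MathematicalPhysics.QuantumManyBody.BoseGas.BoseEinsteinCondensation`, not the sub-problem statement; a NEW conforming route may be opened from the same idea (generated `closes . The file is kept as the record of this route; refuted decls are indexed as negative knowledge (`ledger negatives`).

# Route BECLogConcaveCounts — Gaussian domination of the coarse count law — exchange-flat cell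
counts plus local placement bound the Penrose–Onsager teleportation ratio, hence ODLRO

It suffices to show X = FlatLandscape (the PENROSE–ONSAGER / McMILLAN TELEPORTATION RATIO IS FLAT IN
PROBABILITY): for every repulsive
finite-range v, at all small densities ρ, there are κ, θ > 0 such that for all large N, some δ =
δ(N) > 0 and every δ-near-minimiser Ψ
of the Dirichlet N-body energy in the box Λ of side L = (N/ρ)^{1/3}, the set of pairs (X, x) ∈ Λ^N ×
Λ with
|Ψ(X with x_i ↦ x)|² ≥ κ |Ψ(X)|² has (|Ψ|²dX ⊗ dx)-mass ≥ θ L³ (constants independent of N). Since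
⟨φ₀, γ_{|Ψ|} φ₀⟩ =
N L⁻³ E_{|Ψ|²}∫ |Ψ(X^{i→x})|/|Ψ(X)| dx, X gives the constant mode occupation ≥ √κ·θ·N for |Ψ| by
Markov alone (no logarithms, hard
cores allowed); PhaseCoherence transfers it to Ψ; X_B1 ⇒ BEC is proved (bec_of_zeroMode). The route
realises card
log-concave-counts-brascamp-lieb by splitting X EXACTLY through the coarse cell-count vector n(X)
(cubes of side ≈ ℓ, fixed as N → ∞):
|Ψ(X')|²/|Ψ(X)|² = [P̂(n(X'))/P̂(n(X))] · [conditional density given the counts, at X' vs X], P̂ =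
law of n under |Ψ|². The first factor
is a statement about the COUNT LAW ONLY under a one-particle transfer between two (typically
distant) cells — CountExchangeFlat, the
long-wavelength half, whose engine is Gaussian domination of P̂ by convexity/hyperuniform stiffness
(the card's LC + IR); the second is a
fixed-scale dilute-gas insertion statement — LocalPlacementFlat. X ⟸ CountExchangeFlat ∧
LocalPlacementFlat (union bound);
X ∧ PhaseCoherence ⟹ X_B1 ⟹ BoseEinsteinCondensation.
Lean: `∀ v : ℝ → ℝ≥0∞, Literature.MathematicalPhysics.QuantumManyBody.BoseGas.IsRepulsiveFiniteRange
v → ∃ ρ₀ : ℝ, 0 < ρ₀ ∧ ∀ ρ : ℝ, 0 < ρ → ρ < ρ₀ → ∃ κ : ℝ, 0 < κ ∧ ∃ θ : ℝ, 0 < θ ∧ ∀ᶠ N : ℕ in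
Filter.atTop, ∃ δ : ℝ≥0∞, 0 < δ ∧ ∀ Ψ :
Literature.MathematicalPhysics.QuantumManyBody.BoseGas.TrialState N
(Literature.MathematicalPhysics.QuantumManyBody.BoseGas.sideLength ρ N),
Literature.MathematicalPhysics.QuantumManyBody.BoseGas.energy v Ψ ≤
Literature.MathematicalPhysics.QuantumManyBody.BoseGas.groundStateEnergy v N
(Literature.MathematicalPhysics.QuantumManyBody.BoseGas.sideLength ρ N) + δ → ∀ i : Fin N,
ENNReal.ofReal (θ * Literature.MathematicalPhysics.QuantumManyBody.BoseGas.sideLength ρ N ^ 3) ≤ ∫⁻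
X : Fin N → EuclideanSpace ℝ (Fin 3), ∫⁻ x in
Literature.MathematicalPhysics.QuantumManyBody.BoseGas.box
(Literature.MathematicalPhysics.QuantumManyBody.BoseGas.sideLength ρ N), (if ENNReal.ofReal κ *
(‖Ψ.ψ X‖₊ : ℝ≥0∞) ^ 2 ≤ (‖Ψ.ψ (Function.update X i x)‖₊ : ℝ≥0∞) ^ 2 then (‖Ψ.ψ X‖₊ : ℝ≥0∞) ^ 2 else
0)`

## Assembly
Pure logic from the three glue items: CountLocalSplit gives FlatLandscape from the two flatness
cruxes; FlatLandscapeToZeroMode adds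
PhaseCoherence to reach X_B1; ZeroModeImpliesBEC (proved) finishes. Sketch.lean checks `fun hC hL hP
=> h3 (h2 (h1 hC hL) hP) : Assembly`.

Rationale: WHY THIS LINE. For a positive wave function the "phase" is a functional of the modulus: ODLRO of Ψ ≥
0 is the statement that teleporting one particle to
a uniformly random point costs O(1) in log|Ψ|² with positive probability — Penrose–Onsager's
free-volume estimate (PenroseOnsager1956 §6,
n₀/N ≈ 8% for He-4), Reatto's theorem for the Jastrow class (Reatto1969: ODLRO ⇔ finite insertion
weight of two half-strength impurities
in the associated classical fluid) and McMillan's VMC estimator (McMillan1965) all compute exactly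
this ratio; here it is made a
model-free criterion (FlatLandscape ⇒ BEC, rigorous, Markov only). The new move (card
log-concave-counts-brascamp-lieb, audit grade
new-combination) is to factor the ratio through the coarse COUNT LAW: the long-wavelength physics
(Reatto–Chester 1/r² tail, phonons,
S(k) ≍ k: ReattoChester1967, TorquatoStillinger2003) then lives in a probability statement about a
pmf on ℤ^{cells}, where Gaussian
domination comes from CONVEXITY instead of reflection positivity (BrascampLiebLebowitz1975,
BrascampLieb1976, SpencerZirnbauer2004):
the transfer Fisher information J_d = E[Δ_d²(−log P̂)] — a Jeffreys divergence between P̂ and its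
one-particle translate — obeys the
discrete Fisher identity E[Δ_d²U] = E[Δ_dU(1−e^{−Δ_dU})] (the card's "Ward identity" E e^{−Δ_dU} =
1) and is ≈ (2/ρ)∫d³k(1−cos k·r)/((2π)³S(k))
= O((ρℓ²ξ)⁻¹) uniformly in the transfer distance r in d = 3, log-divergent in d = 1
(Girardeau/Lenard: c₀(N) ≈ 1.54√N), so the
chain reproduces "BEC iff d ≥ 2 at T = 0". Imported areas: convex-measure probability
(log-concavity, Brascamp–Lieb, Fisher
information / Cramér–Rao), point-process statistics (hyperuniformity, Widom/Palm insertion: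
Widom1963), QMC practice (ratio estimators).
What it does that existing routes do not: BECInfraredBound/BECPeriodicReduction type momentum-space
occupations of Dirichlet
near-minimisers (refuters found plane-wave/boundary-layer artefacts, items 0733/0735); this line is
configuration-space, mode-free
except for φ₀ at the very end, "in probability" (walls, cores and boundary layers are absorbed in
η), and needs a LOWER bound on density
fluctuations (S(k) ≳ k: no hidden incompressibility) rather than the usual infrared UPPER bound.
Negatives index: empty.

RANKED CRUXES. #0 FlatLandscape (target) — X as in § Thesis: for (X, x) ~ |Ψ|²dX ⊗ dx on Λ^N × Λ,
|Ψ(X^{i→x})|² ≥ κ|Ψ(X)|² on mass ≥ θL³, for all large N, some δ(N) > 0, every δ-near-minimiser Ψ,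
every particle index i; κ, θ depend on (v, ρ) only. (why it might fail: a positive ground state
could still have a log-normally broad teleportation ratio (Var log-ratio growing with L, as in 1-D
where it grows like ½·log L); in 3-D nothing proved excludes slow growth; NOT implied by BEC itself
for complex states.) [PenroseOnsager1956, Reatto1969, McMillan1965, LSSY2005]
#2 CountExchangeFlat (crux) — COUNT-EXCHANGE FLATNESS (card items LC + IR, merged into their
consequence). Tile [0,L)³ into M³ cubes of side L/M, M = ⌊L/ℓ⌋, ℓ ≥ ℓ₀ fixed as N → ∞; n(X) =
cell-count vector, P̂(m) = |Ψ|²-probability of {n = m}. For every η ∈ (0,1) there is κ > 0 (uniform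
in ℓ ≥ ℓ₀) such that for large N, some δ(N), every δ-near-minimiser and every i, the pairs (X, x)
with P̂(n(X^{i→x})) ≥ κ·P̂(n(X)) — one particle moved from the cell of x_i to the cell of x,
typically a distance ~L apart — have mass ≥ (1−η)L³. Depends on Ψ only through the count law P̂
(size-biased source cell, volume-uniform target cell). Engine: P̂ Gaussian at scales ℓ ≫ ξ with
hyperuniform covariance; J_d = O((ρℓ²ξ)⁻¹) and P(Δ_dU > t) ≤ J_d/(t(1−e^{−t})) by the discrete
Fisher identity; fibre log-concavity (support item) is the unit-scale regularity. v ≡ 0 check: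
multinomial counts, ratio = (π_c/π_{c₁})·n_{c₁}/(n_c+1) ≈ 1 except target cells with expected count
≲ κ, volume fraction ≤ C√(κ/ρℓ³) — holds. [difficulty: open-problem] (why it might fail: needs
density fluctuations bounded BELOW (S(k) ≳ k down to k ~ 1/L for Dirichlet near-minimisers — only
upper bounds are sum-rule cheap) plus unit-scale regularity of P̂; integer/commensuration structure
at scale ℓ or wall pinning of long-wavelength modes would break it.) [ReattoChester1967,
TorquatoStillinger2003, BrascampLiebLebowitz1975, SpencerZirnbauer2004, Lenard1964,
PitaevskiiStringari1991]
#3 LocalPlacementFlat (crux) — LOCAL PLACEMENT FLATNESS (card item LINK): with the same cells, the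
complementary factor — the conditional density of the configuration given its count vector,
[|Ψ(X')|²/P̂(n(X'))]/[|Ψ(X)|²/P̂(n(X))] — is ≥ κ on mass ≥ (1−η)L³, at SOME scale ℓ ≥ ℓ₀ for every
ℓ₀ (a fixed-scale statement, uniform in N). Engine: dilute-gas insertion inside a cell (Widom /
Penrose–Onsager free volume; the Jastrow factor Π_j f(x−y_j)² has x-independent mean exponent and
variance O(√(ρa³)) at low density) and screening of the long-range 1/r² Jastrow tail by the
conditioning on counts (dipole corrections O(α√(ρ/ℓ))). v ≡ 0 check: ratio =
((n_c+1)/n_{c₁})·[φ²(x)/π_c]/[φ²(x_i)/π_{c₁}] ≈ coarse-density ratio of target vs source cell —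
tight. [difficulty: XL] (why it might fail: conditioning on SHARP cell counts may not screen the
Reatto–Chester 1/r² tail or three-body correlations, leaving an L-dependent one-body drift in the
residual; then a finer coarse variable (smoothed / two-scale counts) is needed — a wrong-split
failure, repairable by restating.) [Widom1963, PenroseOnsager1956, ReattoChester1967, Reatto1969,
Fournais2020]
#4 PhaseCoherence (crux) — PHASE COHERENCE OF NEAR-MINIMISERS (the positivity bridge every
configuration-space route needs): for every ε > 0, all large N and some δ(N, ε) > 0, every
δ-near-minimiser Ψ has ⟨φ₀, γ_{|Ψ|} φ₀⟩ ≤ ⟨φ₀, γ_Ψ φ₀⟩ + εN (φ₀ the normalised constant mode). For v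
finite: unique positive Dirichlet ground state (positivity-improving semigroup, Reed–Simon XIII.47)
+ compact resolvent ⇒ δ-near-minimisers are L²-close to the ground ray, and occupations are
2N-Lipschitz in L² ⇒ holds. Absent from Lean (no Schrödinger-operator spectral theory for H_N).
[difficulty: L] (why it might fail: for hard cores (v = ⊤ on [0,a]) uniqueness needs the
N-hard-sphere configuration space in Λ_L to be connected uniformly in N at fixed small ρa³ —
unproved (Diaconis–Lebeau–Michel, Baryshnikov–Bubenik–Kahle treat fixed N); degenerate components
would break it.) [ReedSimonIV1978, PenroseOnsager1956, DiaconisLebeauMichel2010, LSSY2005]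
#9 CountLocalSplit (support) — glue of the split: CountExchangeFlat → LocalPlacementFlat →
FlatLandscape. Pointwise κ₁P̂(n) ≤ P̂(n′) and κ₂|Ψ|²P̂(n′) ≤ |Ψ′|²P̂(n) give κ₁κ₂|Ψ|² ≤ |Ψ′|²
whenever 0 < P̂(n(X)) (true |Ψ|²-a.e.) and P̂ ≤ 1; masses: inclusion–exclusion with η = 1/4 twice
(lintegral_add_right with the measurable weight |Ψ|², no measurability of the events needed), θ =
1/2, κ = κ₁κ₂; quantifier bookkeeping: ℓ₀ from the first crux, ℓ ≥ ℓ₀ from the second, δ = min.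
[difficulty: provable-now] [LSSY2005]
#9 FlatLandscapeToZeroMode (support) — FlatLandscape → PhaseCoherence → X_B1 (zero-mode macroscopic
occupation, verbatim the rank-0 item BecZeroModeThesis of route BECInfraredBound,
stmt-AtomisticToContinuum-0686). Proof: occupation N φ₀ |Ψ| = N L⁻³ ∫dY (∫_Λ |Ψ(x,Y)| dx)² = N L⁻³ ∫
|Ψ(X)|² (∫ |Ψ(X^{0→x})|/|Ψ(X)| dx) dX ≥ N L⁻³ √κ · mass ≥ √κ θ N (Tonelli via
MeasurableEquiv.piFinSuccAbove, Bochner-vs-lintegral for the nonnegative continuous |Ψ|); then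
PhaseCoherence with ε = √κθ/2 and δ = min. [difficulty: M] [PenroseOnsager1956, LSSY2005]
#9 ZeroModeImpliesBEC (support) — X_B1 → BoseEinsteinCondensation — verbatim the assembly item
stmt-AtomisticToContinuum-0687 of route BECInfraredBound, already PROVED
(AtomisticToContinuum.BECInfraredBound.bec_of_zeroMode: occupation_le_maxOccupation +
le_condensateNumber); re-asked so the chain of this route is explicit (Sketch.lean: `example :
ZeroModeImpliesBEC := bec_of_zeroMode` elaborates). [difficulty: provable-now] [LSSY2005,
PenroseOnsager1956]
#9 FibreLogConcaveCounts (support) — the card's headline conjecture LC in fibre form (testable, not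
load-bearing for the assembly): for coarse enough cells (ℓ ≥ ℓ₀), all large N, every slack ε > 0,
some δ and every δ-near-minimiser, the count law is discretely log-concave along every one-particle
transfer line: P̂(m + 2e_j)·P̂(m + 2e_{j′}) ≤ P̂(m + e_j + e_{j′})² + ε (j ≠ j′, all base points m).
Exact for v ≡ 0 (multinomial fibres) and for determinantal moduli (strongly Rayleigh counts,
BorceaBranden2009); Lean precedent for log-concavity in particle number: canonicalZ_logConcave
(ideal gas, thermal). With a fibre-variance floor it implies CountExchangeFlat through the 1-D lemma
P(Δ_dU > t) ≤ C/(σ_fibre(1−e^{−t})). [difficulty: open-problem] [BrascampLieb1976,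
BrascampLiebLebowitz1975, BorceaBranden2009, arXiv:0707.2340]

TWO-LAYER PLAN. Foreseen glued splits (nothing filed now): CountExchangeFlat ⇐ FibreLogConcaveCounts
→ TransferVarianceFloor (conditional variance of
n_c − n_{c′} given the other counts ≥ V(ℓ) → ∞ on most fibres; Cramér–Rao dual of a
transfer-Fisher-information bound) → glue (1-D fibre
lemma + size-bias bookkeeping); ALTERNATIVE split CountExchangeFlat ⇐ TruncatedTransferFisher
(E[min(Δ_dU(1−e^{−Δ_dU}), G)] ≤ J uniformly in
d, N) → glue (Markov). LocalPlacementFlat ⇐ CountScreening (conditional law given counts is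
quasi-local: ratio of conditional densities at
X′, X equals a product of two single-cell insertion/deletion factors up to e^{±o(1)} w.h.p.) →
CellInsertion (fixed cell, n ~ ρℓ³ particles:
insertion factor ≥ κ w.h.p., free-volume/Jastrow estimate) → glue. PhaseCoherence ⇐
UniquePositiveGroundState(v) (fixed N, L: gap +
positivity) → HardCoreConnectivity (configuration space of N hard spheres in Λ_L connected for ρa³ <
c₀, all N) → glue (2N-Lipschitz
occupations).

KILL CRITERIA. FlatLandscape refuted for some admissible v at arbitrarily small ρ (e.g. v ≡ 0 or
hard spheres, by an explicit growth of the log-ratio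
spread with L) closes the route outright (close --reason refuted:FlatLandscape): every
positivity/insertion line dies with it.
CountExchangeFlat refuted at all coarse scales (e.g. via S(k) ≪ k for Dirichlet near-minimisers, or
an integer structure of P̂) ⇒ close.
LocalPlacementFlat refuted ⇒ PIVOT, not close: restate with smoothed or two-scale counts (the split
variable was too coarse).
PhaseCoherence refuted for hard cores ⇒ restate for v finite (and flag the conjunct itself for such
v). X_B1 (shared with
BECInfraredBound) refuted ⇒ pivot FlatLandscapeToZeroMode to an "∃ normalised mode" form
(maxOccupation directly). A proof of
PeriodicBEC + BoundaryTransfer elsewhere (route BECPeriodicReduction) moots the route but not its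
cruxes (they remain the only
configuration-space statements of ODLRO in the tree).

NOT DECOMPOSED YET. The engines are deliberately not items: the discrete Fisher identity / Markov
step, the 1-D fibre lemma, the Gaussian (local CLT)
description of P̂ with hyperuniform covariance and the lower bound S(k) ≳ k it needs (sum rules give
only S(k) ≤ k/2mc; the lower
bound is a compressibility-at-all-scales statement shared in spirit with cards
sector-poincare-two-scale / cramer-rao-no-dilute-solid),
the screening estimate behind LocalPlacementFlat, the uniqueness/positivity package behind
PhaseCoherence, constants (κ(η) ≈ η²ρℓ³
for v ≡ 0), sharp-vs-smoothed cells, the torus and d = 2 versions. They are layer-2 children once a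
crux closes or is split.

CHEAPEST FALSIFIER. (a) v ≡ 0 (Dirichlet free gas, admissible): all four statements must hold and
do, by hand — counts multinomial (exchange ratio
(π_c/π_{c₁})·n_{c₁}/(n_c+1), bad volume fraction ≤ C√(κ/ρℓ³)); local ratio ≈ coarse density ratio
g(x/L)/g(x_i/L), g = 8Πsin², tight;
fibre log-concavity exact ((a+k)!(b−k)! log-convex); ground state Πsin unique positive. A refuter
should re-derive these with constants
first. (b) kit, node-hours: classical Metropolis for the hard-sphere Jastrow proxy Π(1−a/r_ij)²₊ at
ρa³ = 10⁻³, N = 10³–10⁴, cells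
ℓ = 2ξ, 4ξ: histogram the count ratio P̂(n − e_{c₁} + e_c)/P̂(n) (estimated from the empirical fibre
pmf of n_c − n_{c′} given coarse
neighbours) and the fibre second differences; mass > 10% below κ = e⁻³ at ℓ = 4ξ that GROWS with L
kills CountExchangeFlat for the proxy
and makes the crux implausible for Ψ₀. (c) 1-D consistency (must FAIL and does): for the Girardeau
state the count-transfer cost grows
like ½·log(r k_F) (S(k) = |k|/2k_F), matching c₀(N) ≈ 1.54√N (OneDimensionalHardCore). Not run this
session (kit not in payload).

NUMBERS. ξ = (8πρa)^{-1/2}; ρξ³ = (8π)^{-3/2}(ρa³)^{-1/2}; transfer Fisher information J_d ≈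
C/(ρℓ²ξ) ≤ C(8π)^{3/2}√(ρa³)(ξ/ℓ)² in d = 3,
≈ (1/K)·log(r/ℓ) in d = 1 (Luttinger K = 1 for Girardeau: g₁ ~ r^{-1/2}); intra-cell Jastrow
exponent mean 2πρaR² (R = screening radius),
variance 4πρa²R ~ √(ρa³)·R/ξ; free Dirichlet gas φ₀-fraction (8/π²)³ ≈ 0.533 (refuter g2-4 on
stmt-0733); Penrose–Onsager He-4 estimate
n₀/N ≈ 0.08 = mean free-volume fraction of the hard-sphere proxy (PenroseOnsager1956 (35));
hyperuniform number variance in a window of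
side ℓ: ~ ρℓ²ξ (surface law) vs Poisson ρℓ³ (TorquatoStillinger2003).

DEFINITION REQUESTS. None filed: cell counts, the count law and the teleported configuration are
written inline (Function.update, Nat.floor, finite sums,
lintegrals; Sketch.lean rc 0). Provers may introduce `cellCount` / `countLaw` helpers in Theorems.
No cite facts wanted: the proved
assembly bec_of_zeroMode is re-asked verbatim (ZeroModeImpliesBEC), Brascamp–Lieb enters only inside
proofs of support items.

Novelty: Searches (2026-08-15; local searchd down rc 104, OpenAlex 429 — remote crossref/galaxy used): lit
search --source crossref "Reatto
Bose-Einstein condensation class of wave functions Jastrow" (5; doi:10.1103/physrev.183.334 found),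
"phonons properties Bose system
Reatto Chester long range Jastrow" (5; doi:10.1103/physrev.155.88), "McMillan ground state liquid
He4 Monte Carlo 1965" (5),
"wave function ratio estimator one-body density matrix Bose condensate Monte Carlo" (8, QMC
methodology only); lit galaxy search --star
all "condensate fraction free volume Penrose Onsager hard sphere" (0); lit galaxy search --star
panama --mode bm25 "ratio of the trial
wave function … one-body density matrix and condensate fraction" (10: Becca–Sorella,
Gubernatis–Kawashima–Werner, Lester–Hammond–Reynolds
— the ratio ESTIMATOR is textbook, no theorem); lit frontier AtomisticToContinuum --since 2020 (BEC
descendants arXiv:2603.20776,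
arXiv:2510.20493, doi:10.1016/j.jfa.2026.111542: Neumann/Poincaré localisation, length-scale BEC —
momentum/energy side only); lit
bridges AtomisticToContinuum --cross any (30 rows, none on BEC criteria); plus the card's and
audit-13's searches (BLL1975, BL1976,
SZ2004, DSZ doi:10.1007/s00220-010-1117-5, arXiv:0707.2340; zbMATH "log-concave partition function
canonical ensemble" 0,
"log-concavity number of particles Gibbs point process" 0 beyond real-rooted lattice cases); lean
search LogConcave (project:
canonicalZ_logConcave, ideal-gas thermal; Mathlib: none).
Near  [refs: 10.1103/physrev.183.334, 10.1103/physrev.155.88, 10.1016/j.jfa.2026.111542:, 10.1007/s00220-010-1117-5, 10.1103/physrev.183.334:, 2603.20776, 2510.20493, 0707.2340, doi:10.1103/physrev.183.334, doi:10.1103/physrev.155.88, doi:10.1016/j.jfa.2026.111542, doi:10.1007/s00220-010-1117-5, Reatto1969, PenroseOnsager1956, BrascampLiebLebowitz1975, SpencerZirnbauer2004]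

Barriers (technique_class: count-law-convexity positivity-ratio hyperuniformity): - technique_class: count-law-convexity positivity-ratio hyperuniformity
- Literature.Barriers.AtomisticToContinuum.HalfFillingReflectionPositivity: evaded by construction —
no reflection, lattice, particle–hole symmetry or chessboard estimate; Gaussian domination is a
property asked of the COUNT LAW (convexity / local CLT), the precedent being BLL1975/SZ2004
order-by-convexity without RP; the bet is that P̂ is convex enough, which is testable
(FibreLogConcaveCounts).
- Literature.Barriers.AtomisticToContinuum.KineticGapLengthScales: evaded — no Poincaré/kinetic-gap
inequality at scale L is used; the scale-L input is a count-law tail bound (CountExchangeFlat) and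
the only gap-type input is at the FIXED scale ℓ (LocalPlacementFlat), where Fournais-type
localisation is a tool, not a ceiling.
- Literature.Barriers.AtomisticToContinuum.OneDimensionalHardCore: respected and used as a check —
the Girardeau state is positive and fails CountExchangeFlat (transfer cost ½·log r), consistent with
c₀(N) ~ 1.54√N; the chain gives nothing in d = 1.
- Literature.Barriers.AtomisticToContinuum.PitaevskiiStringariOneDimension: respected — their S(q) ≤
q/2mc is the harmless upper bound; the route needs and states the LOWER-bound direction, whose d = 1
consequence (log divergence of ∫dk/S) is exactly their no-BEC conclusion.
- Literature.Barriers.AtomisticToContinuum.HohenbergLowDimension: not contradicted — thermal states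
are not positive wave functions; the T = 0, d = 3 cube is the only regime

History (route lifecycle, newest last):
- 2026-08-15T13:39:16Z · CLOSED retired — not-a-thesis: assembly does not conclude the sub-problem Statement (operator:999:1257524)

sub-problem: BoseEinsteinCondensation · status: closed(retired) · opened planner-plancard-AtomisticToContinuum-BoseEin-b85a4d9d-0 2026-08-15T11:25:28Z · rev 0 · ledger route-AtomisticToContinuum-BECLogConcaveCounts
GENERATED by the gate from the ledger (D-0016/17). Provers cite these decls: `theorem foo : Summit.AtomisticToContinuum.BoseEinsteinCondensation.Theses.BECLogConcaveCounts.<Decl> := …` in Summits/AtomisticToContinuum/BoseEinsteinCondensation/Theorems/<Name>.lean.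
-/

namespace Summit.AtomisticToContinuum.BoseEinsteinCondensation.Theses.BECLogConcaveCounts

open scoped BigOperators Topology Manifold Classical MeasureTheory ProbabilityTheory Matrix InnerProductSpace ComplexConjugate ContinuousMap Real NNReal ENNReal
open Filter Set Function TopologicalSpace MeasureTheory

attribute [summit_statement] _root_.BoseEinsteinCondensation

/-- item stmt-AtomisticToContinuum-3859 · target · rank 0 · closed · moot by None · by planner
why it might fail: a positive ground state could still have a log-normally broad teleportation ratio (Var log-ratio growing with L, as in 1-D where it grows like ½·log L); in 3-D nothing proved excludes slow growth; NOT implied by BEC itself for complex states.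
sources: PenroseOnsager1956, Reatto1969, McMillan1965, LSSY2005
[target] X as in § Thesis: for (X, x) ~ |Ψ|²dX ⊗ dx on Λ^N × Λ, |Ψ(X^{i→x})|² ≥ κ|Ψ(X)|² on mass ≥
θL³, for all large N, some δ(N) > 0, every δ-near-minimiser Ψ, every particle index i; κ, θ depend
on (v, ρ) only. -/
@[route_item "route-AtomisticToContinuum-BECLogConcaveCounts"]
def FlatLandscape : Prop :=
  ∀ v : ℝ → ℝ≥0∞, Literature.MathematicalPhysics.QuantumManyBody.BoseGas.IsRepulsiveFiniteRange v → ∃ ρ₀ : ℝ, 0 < ρ₀ ∧ ∀ ρ : ℝ, 0 < ρ → ρ < ρ₀ → ∃ κ : ℝ, 0 < κ ∧ ∃ θ : ℝ, 0 < θ ∧ ∀ᶠ N : ℕ in Filter.atTop, ∃ δ : ℝ≥0∞, 0 < δ ∧ ∀ Ψ : Literature.MathematicalPhysics.QuantumManyBody.BoseGas.TrialState N (Literature.MathematicalPhysics.QuantumManyBody.BoseGas.sideLength ρ N), Literature.MathematicalPhysics.QuantumManyBody.BoseGas.energy v Ψ ≤ Literature.MathematicalPhysics.QuantumManyBody.BoseGas.groundStateEnergy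 v N (Literature.MathematicalPhysics.QuantumManyBody.BoseGas.sideLength ρ N) + δ → ∀ i : Fin N, ENNReal.ofReal (θ * Literature.MathematicalPhysics.QuantumManyBody.BoseGas.sideLength ρ N ^ 3) ≤ ∫⁻ X : Fin N → EuclideanSpace ℝ (Fin 3), ∫⁻ x in Literature.MathematicalPhysics.QuantumManyBody.BoseGas.box (Literature.MathematicalPhysics.QuantumManyBody.BoseGas.sideLength ρ N), (if ENNReal.ofReal κ * (‖Ψ.ψ X‖₊ : ℝ≥0∞) ^ 2 ≤ (‖Ψ.ψ (Function.update X i x)‖₊ : ℝ≥0∞) ^ 2 then (‖Ψ.ψ X‖₊ : ℝ≥0∞) ^ 2 else 0)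

/-- item stmt-AtomisticToContinuum-3860 · crux · rank 2 · closed · moot by None · by planner
why it might fail: needs density fluctuations bounded BELOW (S(k) ≳ k down to k ~ 1/L for Dirichlet near-minimisers — only upper bounds are sum-rule cheap) plus unit-scale regularity of P̂; integer/commensuration structure at scale ℓ or wall pinning of long-wavelength modes would break it.
sources: ReattoChester1967, TorquatoStillinger2003, BrascampLiebLebowitz1975, SpencerZirnbauer2004, Lenard1964, PitaevskiiStringari1991
[crux] COUNT-EXCHANGE FLATNESS (card items LC + IR, merged into their consequence). Tile [0,L)³ into
M³ cubes of side L/M, M = ⌊L/ℓ⌋, ℓ ≥ ℓ₀ fixed as N → ∞; n(X) = cell-count vector, P̂(m) =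
|Ψ|²-probability of {n = m}. For every η ∈ (0,1) there is κ > 0 (uniform in ℓ ≥ ℓ₀) such that for
large N, some δ(N), every δ-near-minimiser and every i, the pairs (X, x) with P̂(n(X^{i→x})) ≥
κ·P̂(n(X)) — one particle moved from the cell of x_i to the cell of x, typically a distance ~L apart
— have mass ≥ (1−η)L³. Depends on Ψ only through the count law P̂ (size-biased source cell,
volume-uniform target cell). Engine: P̂ Gaussian at scales ℓ ≫ ξ with hyperuniform covariance; J_d =
O((ρℓ²ξ)⁻¹) and P(Δ_dU > t) ≤ J_d/(t(1−e^{−t})) by the discrete Fisher identity; fibre log-concavity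
(support item) is the unit-scale regularity. v ≡ 0 check: multinomial counts, ratio =
(π_c/π_{c₁})·n_{c₁}/(n_c+1) ≈ 1 except target cells with expected count ≲ κ, volume fraction ≤
C√(κ/ρℓ³) — holds. [difficulty: open-problem] -/
@[route_item "route-AtomisticToContinuum-BECLogConcaveCounts"]
def CountExchangeFlat : Prop :=
  ∀ v : ℝ → ℝ≥0∞, Literature.MathematicalPhysics.QuantumManyBody.BoseGas.IsRepulsiveFiniteRange v → ∃ ρ₀ : ℝ, 0 < ρ₀ ∧ ∀ ρ : ℝ, 0 < ρ → ρ < ρ₀ → ∀ η : ℝ, 0 < η → η < 1 → ∃ κ : ℝ, 0 < κ ∧ ∃ ℓ₀ : ℝ, 0 < ℓ₀ ∧ ∀ ℓ : ℝ, ℓ₀ ≤ ℓ → ∀ᶠ N : ℕ in Filter.atTop, ∀ L : ℝ, L = Literature.MathematicalPhysics.QuantumManyBody.BoseGas.sideLength ρ N → ∀ M : ℕ, M = ⌊L / ℓ⌋₊ → ∀ cnt : (Fin N → EuclideanSpace ℝ (Fin 3)) → (Fin 3 → Fin M) → ℕ, cnt = (fun X j => ∑ i : Fin N, if (∀ k :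 Fin 3, X i k ∈ Set.Ico (((j k : ℕ) : ℝ) * (L / M)) ((((j k : ℕ) : ℝ) + 1) * (L / M))) then 1 else 0) → ∃ δ : ℝ≥0∞, 0 < δ ∧ ∀ Ψ : Literature.MathematicalPhysics.QuantumManyBody.BoseGas.TrialState N L, Literature.MathematicalPhysics.QuantumManyBody.BoseGas.energy v Ψ ≤ Literature.MathematicalPhysics.QuantumManyBody.BoseGas.groundStateEnergy v N L + δ → ∀ claw : ((Fin 3 → Fin M) → ℕ) → ℝ≥0∞, claw = (fun m => ∫⁻ Z : Fin N → EuclideanSpace ℝ (Fin 3), if cnt Z = m then (‖Ψ.ψ Z‖₊ : ℝ≥0∞) ^ 2 else 0) → ∀ i : Fin N, ENNReal.ofReal ((1 - η) * L ^ 3) ≤ ∫⁻ X : Fin N → EuclideanSpace ℝ (Fin 3), ∫⁻ x in Literature.MathematicalPhysics.QuantumManyBody.BoseGas.box L, (if ENNReal.ofReal κ * claw (cnt X) ≤ claw (cnt (Function.update X i x)) then (‖Ψ.ψ X‖₊ : ℝ≥0∞) ^ 2 else 0)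

/-- item stmt-AtomisticToContinuum-3861 · crux · rank 3 · closed · moot by None · by planner
why it might fail: conditioning on SHARP cell counts may not screen the Reatto–Chester 1/r² tail or three-body correlations, leaving an L-dependent one-body drift in the residual; then a finer coarse variable (smoothed / two-scale counts) is needed — a wrong-split failure, repairable by restating.
sources: Widom1963, PenroseOnsager1956, ReattoChester1967, Reatto1969, Fournais2020
[crux] LOCAL PLACEMENT FLATNESS (card item LINK): with the same cells, the complementary factor —
the conditional density of the configuration given its count vector,
[|Ψ(X')|²/P̂(n(X'))]/[|Ψ(X)|²/P̂(n(X))] — is ≥ κ on mass ≥ (1−η)L³, at SOME scale ℓ ≥ ℓ₀ for every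
ℓ₀ (a fixed-scale statement, uniform in N). Engine: dilute-gas insertion inside a cell (Widom /
Penrose–Onsager free volume; the Jastrow factor Π_j f(x−y_j)² has x-independent mean exponent and
variance O(√(ρa³)) at low density) and screening of the long-range 1/r² Jastrow tail by the
conditioning on counts (dipole corrections O(α√(ρ/ℓ))). v ≡ 0 check: ratio =
((n_c+1)/n_{c₁})·[φ²(x)/π_c]/[φ²(x_i)/π_{c₁}] ≈ coarse-density ratio of target vs source cell —
tight. [difficulty: XL] -/
@[route_item "route-AtomisticToContinuum-BECLogConcaveCounts"]
def LocalPlacementFlat : Prop :=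
  ∀ v : ℝ → ℝ≥0∞, Literature.MathematicalPhysics.QuantumManyBody.BoseGas.IsRepulsiveFiniteRange v → ∃ ρ₀ : ℝ, 0 < ρ₀ ∧ ∀ ρ : ℝ, 0 < ρ → ρ < ρ₀ → ∀ η : ℝ, 0 < η → η < 1 → ∀ ℓ₀ : ℝ, 0 < ℓ₀ → ∃ ℓ : ℝ, ℓ₀ ≤ ℓ ∧ ∃ κ : ℝ, 0 < κ ∧ ∀ᶠ N : ℕ in Filter.atTop, ∀ L : ℝ, L = Literature.MathematicalPhysics.QuantumManyBody.BoseGas.sideLength ρ N → ∀ M : ℕ, M = ⌊L / ℓ⌋₊ → ∀ cnt : (Fin N → EuclideanSpace ℝ (Fin 3)) → (Fin 3 → Fin M) → ℕ, cnt = (fun X j => ∑ i : Fin N, if (∀ k : Fin 3, X i k ∈ Set.Ico (((j k : ℕ) : ℝ) * (L / M)) ((((j k : ℕ) : ℝ) + 1) * (L / M))) then 1 else 0) → ∃ δ : ℝ≥0∞, 0 < δ ∧ ∀ Ψ : Literature.MathematicalPhysics.QuantumManyBody.BoseGas.TrialState N L, Literature.MathematicalPhysics.QuantumManyBody.BoseGas.energy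 v Ψ ≤ Literature.MathematicalPhysics.QuantumManyBody.BoseGas.groundStateEnergy v N L + δ → ∀ claw : ((Fin 3 → Fin M) → ℕ) → ℝ≥0∞, claw = (fun m => ∫⁻ Z : Fin N → EuclideanSpace ℝ (Fin 3), if cnt Z = m then (‖Ψ.ψ Z‖₊ : ℝ≥0∞) ^ 2 else 0) → ∀ i : Fin N, ENNReal.ofReal ((1 - η) * L ^ 3) ≤ ∫⁻ X : Fin N → EuclideanSpace ℝ (Fin 3), ∫⁻ x in Literature.MathematicalPhysics.QuantumManyBody.BoseGas.box L, (if ENNReal.ofReal κ * (‖Ψ.ψ X‖₊ : ℝ≥0∞) ^ 2 * claw (cnt (Function.update X i x)) ≤ (‖Ψ.ψ (Function.update X i x)‖₊ : ℝ≥0∞) ^ 2 * claw (cnt X) then (‖Ψ.ψ X‖₊ : ℝ≥0∞) ^ 2 else 0)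

/-- item stmt-AtomisticToContinuum-3862 · crux · rank 4 · closed · moot by None · by planner
why it might fail: for hard cores (v = ⊤ on [0,a]) uniqueness needs the N-hard-sphere configuration space in Λ_L to be connected uniformly in N at fixed small ρa³ — unproved (Diaconis–Lebeau–Michel, Baryshnikov–Bubenik–Kahle treat fixed N); degenerate components would break it.
sources: ReedSimonIV1978, PenroseOnsager1956, DiaconisLebeauMichel2010, LSSY2005
[crux] PHASE COHERENCE OF NEAR-MINIMISERS (the positivity bridge every configuration-space route
needs): for every ε > 0, all large N and some δ(N, ε) > 0, every δ-near-minimiser Ψ has ⟨φ₀, γ_{|Ψ|}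
φ₀⟩ ≤ ⟨φ₀, γ_Ψ φ₀⟩ + εN (φ₀ the normalised constant mode). For v finite: unique positive Dirichlet
ground state (positivity-improving semigroup, Reed–Simon XIII.47) + compact resolvent ⇒
δ-near-minimisers are L²-close to the ground ray, and occupations are 2N-Lipschitz in L² ⇒ holds.
Absent from Lean (no Schrödinger-operator spectral theory for H_N). [difficulty: L] -/
@[route_item "route-AtomisticToContinuum-BECLogConcaveCounts"]
def PhaseCoherence : Prop :=
  ∀ v : ℝ → ℝ≥0∞, Literature.MathematicalPhysics.QuantumManyBody.BoseGas.IsRepulsiveFiniteRange v → ∃ ρ₀ : ℝ, 0 < ρ₀ ∧ ∀ ρ : ℝ, 0 < ρ → ρ < ρ₀ → ∀ ε : ℝ, 0 < ε → ∀ᶠ N : ℕ in Filter.atTop, ∃ δ : ℝ≥0∞, 0 < δ ∧ ∀ Ψ : Literature.MathematicalPhysics.QuantumManyBody.BoseGas.TrialState N (Literature.MathematicalPhysics.QuantumManyBody.BoseGas.sideLength ρ N), Literature.MathematicalPhysics.QuantumManyBody.BoseGas.energy v Ψ ≤ Literature.MathematicalPhysics.QuantumManyBody.BoseGas.groundStateEnergy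 v N (Literature.MathematicalPhysics.QuantumManyBody.BoseGas.sideLength ρ N) + δ → Literature.MathematicalPhysics.QuantumManyBody.BoseGas.occupation N ((Literature.MathematicalPhysics.QuantumManyBody.BoseGas.box (Literature.MathematicalPhysics.QuantumManyBody.BoseGas.sideLength ρ N)).indicator fun _ => ((Real.sqrt (Literature.MathematicalPhysics.QuantumManyBody.BoseGas.sideLength ρ N ^ 3))⁻¹ : ℂ)) (fun X => ((‖Ψ.ψ X‖ : ℝ) : ℂ)) ≤ Literature.MathematicalPhysics.QuantumManyBody.BoseGas.occupation N ((Literature.MathematicalPhysics.QuantumManyBody.BoseGas.box (Literature.MathematicalPhysics.QuantumManyBody.BoseGas.sideLength ρ N)).indicator fun _ => ((Real.sqrt (Literature.MathematicalPhysics.QuantumManyBody.BoseGas.sideLength ρ N ^ 3))⁻¹ : ℂ)) Ψ.ψ + ENNReal.ofReal (ε * N)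

/-- item stmt-AtomisticToContinuum-3863 · support · rank 9 · closed · moot by None · by planner
sources: LSSY2005
[support] glue of the split: CountExchangeFlat → LocalPlacementFlat → FlatLandscape. Pointwise
κ₁P̂(n) ≤ P̂(n′) and κ₂|Ψ|²P̂(n′) ≤ |Ψ′|²P̂(n) give κ₁κ₂|Ψ|² ≤ |Ψ′|² whenever 0 < P̂(n(X)) (true
|Ψ|²-a.e.) and P̂ ≤ 1; masses: inclusion–exclusion with η = 1/4 twice (lintegral_add_right with the
measurable weight |Ψ|², no measurability of the events needed), θ = 1/2, κ = κ₁κ₂; quantifier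
bookkeeping: ℓ₀ from the first crux, ℓ ≥ ℓ₀ from the second, δ = min. [difficulty: provable-now] -/
@[route_item "route-AtomisticToContinuum-BECLogConcaveCounts"]
def CountLocalSplit : Prop :=
  CountExchangeFlat → LocalPlacementFlat → FlatLandscape

/-- item stmt-AtomisticToContinuum-3864 · support · rank 9 · closed · moot by None · by planner
sources: PenroseOnsager1956, LSSY2005
[support] FlatLandscape → PhaseCoherence → X_B1 (zero-mode macroscopic occupation, verbatim the
rank-0 item BecZeroModeThesis of route BECInfraredBound, stmt-AtomisticToContinuum-0686). Proof:
occupation N φ₀ |Ψ| = N L⁻³ ∫dY (∫_Λ |Ψ(x,Y)| dx)² = N L⁻³ ∫ |Ψ(X)|² (∫ |Ψ(X^{0→x})|/|Ψ(X)| dx) dX ≥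
N L⁻³ √κ · mass ≥ √κ θ N (Tonelli via MeasurableEquiv.piFinSuccAbove, Bochner-vs-lintegral for the
nonnegative continuous |Ψ|); then PhaseCoherence with ε = √κθ/2 and δ = min. [difficulty: M] -/
@[route_item "route-AtomisticToContinuum-BECLogConcaveCounts"]
def FlatLandscapeToZeroMode : Prop :=
  FlatLandscape → PhaseCoherence → (∀ v : ℝ → ENNReal, Literature.MathematicalPhysics.QuantumManyBody.BoseGas.IsRepulsiveFiniteRange v → ∃ ρ₀ : ℝ, 0 < ρ₀ ∧ ∀ ρ : ℝ, 0 < ρ → ρ < ρ₀ → ∃ c : ℝ, 0 < c ∧ ∀ᶠ N : ℕ in Filter.atTop, ∃ δ : ENNReal, 0 < δ ∧ ∀ Ψ : Literature.MathematicalPhysics.QuantumManyBody.BoseGas.TrialState N (Literature.MathematicalPhysics.QuantumManyBody.BoseGas.sideLength ρ N), Literature.MathematicalPhysics.QuantumManyBody.BoseGas.energy v Ψ ≤ Literature.MathematicalPhysics.QuantumManyBody.BoseGas.groundStateEnergy v N (Literature.MathematicalPhysics.QuantumManyBody.BoseGas.sideLength ρ N) + δ → ENNReal.ofReal (c * N)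 ≤ Literature.MathematicalPhysics.QuantumManyBody.BoseGas.occupation N ((Literature.MathematicalPhysics.QuantumManyBody.BoseGas.box (Literature.MathematicalPhysics.QuantumManyBody.BoseGas.sideLength ρ N)).indicator fun _ => ((Real.sqrt (Literature.MathematicalPhysics.QuantumManyBody.BoseGas.sideLength ρ N ^ 3))⁻¹ : ℂ)) Ψ.ψ)

/-- item stmt-AtomisticToContinuum-3865 · support · rank 9 · closed · moot by None · by planner
sources: LSSY2005, PenroseOnsager1956
[support] X_B1 → BoseEinsteinCondensation — verbatim the assembly item
stmt-AtomisticToContinuum-0687 of route BECInfraredBound, already PROVED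
(AtomisticToContinuum.BECInfraredBound.bec_of_zeroMode: occupation_le_maxOccupation +
le_condensateNumber); re-asked so the chain of this route is explicit (Sketch.lean: `example :
ZeroModeImpliesBEC := bec_of_zeroMode` elaborates). [difficulty: provable-now] -/
@[route_item "route-AtomisticToContinuum-BECLogConcaveCounts"]
def ZeroModeImpliesBEC : Prop :=
  (∀ v : ℝ → ENNReal, Literature.MathematicalPhysics.QuantumManyBody.BoseGas.IsRepulsiveFiniteRange v → ∃ ρ₀ : ℝ, 0 < ρ₀ ∧ ∀ ρ : ℝ, 0 < ρ → ρ < ρ₀ → ∃ c : ℝ, 0 < c ∧ ∀ᶠ N : ℕ in Filter.atTop, ∃ δ : ENNReal, 0 < δ ∧ ∀ Ψ : Literature.MathematicalPhysics.QuantumManyBody.BoseGas.TrialState N (Literature.MathematicalPhysics.QuantumManyBody.BoseGas.sideLength ρ N), Literature.MathematicalPhysics.QuantumManyBody.BoseGas.energy v Ψ ≤ Literature.MathematicalPhysics.QuantumManyBody.BoseGas.groundStateEnergy v N (Literature.MathematicalPhysics.QuantumManyBody.BoseGas.sideLength ρ N) + δ → ENNReal.ofReal (c * N) ≤ Literature.MathematicalPhysics.QuantumManyBody.BoseGas.occupation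 N ((Literature.MathematicalPhysics.QuantumManyBody.BoseGas.box (Literature.MathematicalPhysics.QuantumManyBody.BoseGas.sideLength ρ N)).indicator fun _ => ((Real.sqrt (Literature.MathematicalPhysics.QuantumManyBody.BoseGas.sideLength ρ N ^ 3))⁻¹ : ℂ)) Ψ.ψ) → Literature.MathematicalPhysics.QuantumManyBody.BoseGas.BoseEinsteinCondensation

/-- item stmt-AtomisticToContinuum-3866 · support · rank 9 · closed · moot by None · by planner
sources: BrascampLieb1976, BrascampLiebLebowitz1975, BorceaBranden2009, arXiv:0707.2340
[support] the card's headline conjecture LC in fibre form (testable, not load-bearing for the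
assembly): for coarse enough cells (ℓ ≥ ℓ₀), all large N, every slack ε > 0, some δ and every
δ-near-minimiser, the count law is discretely log-concave along every one-particle transfer line:
P̂(m + 2e_j)·P̂(m + 2e_{j′}) ≤ P̂(m + e_j + e_{j′})² + ε (j ≠ j′, all base points m). Exact for v ≡
0 (multinomial fibres) and for determinantal moduli (strongly Rayleigh counts, BorceaBranden2009);
Lean precedent for log-concavity in particle number: canonicalZ_logConcave (ideal gas, thermal).
With a fibre-variance floor it implies CountExchangeFlat through the 1-D lemma P(Δ_dU > t) ≤
C/(σ_fibre(1−e^{−t})). [difficulty: open-problem] -/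
@[route_item "route-AtomisticToContinuum-BECLogConcaveCounts"]
def FibreLogConcaveCounts : Prop :=
  ∀ v : ℝ → ℝ≥0∞, Literature.MathematicalPhysics.QuantumManyBody.BoseGas.IsRepulsiveFiniteRange v → ∃ ρ₀ : ℝ, 0 < ρ₀ ∧ ∀ ρ : ℝ, 0 < ρ → ρ < ρ₀ → ∃ ℓ₀ : ℝ, 0 < ℓ₀ ∧ ∀ ℓ : ℝ, ℓ₀ ≤ ℓ → ∀ᶠ N : ℕ in Filter.atTop, ∀ L : ℝ, L = Literature.MathematicalPhysics.QuantumManyBody.BoseGas.sideLength ρ N → ∀ M : ℕ, M = ⌊L / ℓ⌋₊ → ∀ cnt : (Fin N → EuclideanSpace ℝ (Fin 3)) → (Fin 3 → Fin M) → ℕ, cnt = (fun X j => ∑ i : Fin N, if (∀ k : Fin 3, X i k ∈ Set.Ico (((j k : ℕ) : ℝ) * (L / M)) ((((j k : ℕ) : ℝ) + 1) * (L / M))) then 1 else 0) → ∀ ε : ℝ≥0∞, 0 < ε → ∃ δ : ℝ≥0∞, 0 < δ ∧ ∀ Ψ : Literature.MathematicalPhysics.QuantumManyBody.BoseGas.TrialState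 N L, Literature.MathematicalPhysics.QuantumManyBody.BoseGas.energy v Ψ ≤ Literature.MathematicalPhysics.QuantumManyBody.BoseGas.groundStateEnergy v N L + δ → ∀ claw : ((Fin 3 → Fin M) → ℕ) → ℝ≥0∞, claw = (fun m => ∫⁻ Z : Fin N → EuclideanSpace ℝ (Fin 3), if cnt Z = m then (‖Ψ.ψ Z‖₊ : ℝ≥0∞) ^ 2 else 0) → ∀ m : (Fin 3 → Fin M) → ℕ, ∀ j j' : Fin 3 → Fin M, j ≠ j' → claw (m + Pi.single j 2) * claw (m + Pi.single j' 2) ≤ claw (m + Pi.single j 1 + Pi.single j' 1) ^ 2 + ε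

/-- item stmt-AtomisticToContinuum-3867 · assembly · rank 1 · closed · moot by None · by planner
sources: LSSY2005, PenroseOnsager1956
[assembly] CountExchangeFlat → LocalPlacementFlat → PhaseCoherence → BoseEinsteinCondensation (the
conjunct constant Literature.MathematicalPhysics.QuantumManyBody.BoseGas.BoseEinsteinCondensation, =
abbrev BoseEinsteinCondensation of the sub-problem Statement). -/
@[route_item "route-AtomisticToContinuum-BECLogConcaveCounts"]
def Assembly : Prop :=
  CountExchangeFlat → LocalPlacementFlat → PhaseCoherence → Literature.MathematicalPhysics.QuantumManyBody.BoseGas.BoseEinsteinCondensation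

end Summit.AtomisticToContinuum.BoseEinsteinCondensation.Theses.BECLogConcaveCounts
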